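import Mathlib.Algebra.Module.Submodule.Pointwise
import Mathlib.RingTheory.Ideal.Operations
import Mathlib.RingTheory.LocalRing.Basic
import Mathlib.LinearAlgebra.Quotient.Basic
import HarnessLib

/-!
# A saturation criterion from the congruence ideal (a second repair of the `Sat-prop2` step of BSTW Prop. 4.12)

Pure commutative algebra, sorry-free; companion to `IwasawaSaturationCriterion.lean` (same namespace), which
records reader 1's **Lemma S** for the same line. This file records reader 2's **Lemma C**
(`pub/bsd-litref/cgs25/sheets/D-AUDIT-cgs25-r2-ADDENDUM-3.md` §2, sha16 aac631bf3c460e39), an INDEPENDENT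
repair of the inference «it suffices to show that the minimal number of generators of `𝐓̂_P ⊗ Q̄_p⟦X⟧` is one
more than that of `𝐓̂_P⁻ ⊗ Q̄_p⟦X⟧`» in the printed proof of Burungale–Skinner–Tian–Wan, arXiv:2409.01350v2,
Part I, Prop. 4.12 (TeX l.3385–3388) — the line on which referee C ROUND 381 (ζ) recorded a valid counterexample
to the inference AS WORDED, adjudicated at referee C4 ROUND C4-R3 (ε) («statement holds; PASS-in-cell with reader
repair»).

The point of this route: it uses NEITHER the generator count NOR the structure of the quotient `T⁻` (so not
BSTW Prop. 4.10's case analysis), but the CONGRUENCE IDEAL of the branch. In the application `R = 𝒯_f` is the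
completed local ring of the eigencurve at the `p`-irregular weight-one CM point `f = θ_{ψ_r}` (a local ring, finite
and flat over `Λ = Q̄_p⟦X⟧`), `𝔞 = ker(π_ψ : 𝒯_f ↠ Λ)` is the CM branch, `H` is Ohta's ordinary `Λ`-adic
cohomology completed at `f` with its `I_p`-non-trivial line `H⁺ = R·e ≅ R` (BSTW Thm. 4.1(i)) and `H/H⁺ ≅ Hom_Λ(R, Λ)`
torsion-free (BSTW (HidaDu), l.3332), and `X` is (the image in `R` of) the uniformiser of `Λ`. The one external
input is an element `ρ ∈ Ann_R(𝔞)` with `π_ψ(ρ) = X`, i.e. the congruence ideal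
`C⁰_ψ = π_ψ(Ann_R 𝔞)` equals `(X)` — which is Betina–Dimitrov, Adv. Math. 384 (2021), Thm. 4.8
(`C⁰_ψ = (X) ⟺ 𝓛_−(ψ_−) ≠ 0`) together with their Prop. 1.11 (one of `𝓛_−(ψ_−)`, `𝓛_−(ψ_−^τ)` is non-zero),
applied on whichever of the two conjugate CM branches through `f` is transversal; the statement of Prop. 4.12 over
`Λ_{L,P}^v` descends from either by faithful flatness (BSTW l.3362–3364).

The lemmas (elementwise, no finiteness, no DVR hypothesis on `R`):

* `ne_smul_add_of_sub_mem_of_mul_eq_zero` — **Lemma C**: `R` local, `e ∈ H` with trivial annihilator,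
  `R ∙ e` `X`-saturated in `H`, `X` a non-zero-divisor on `H`, `ρ𝔞 = 0`, `ρ − X ∈ 𝔞`, `X ∉ 𝔞`, `𝔞 ≠ 0`.
  Then `e ≠ X • h + t` whenever `X^N • t ∈ 𝔞H` — i.e. the image `ē` of `e` in `B := H/𝔞H` does not lie in
  `X • B + B[X^∞]`, which says exactly that the line `Λē` is saturated in `B/B_{tors}` (the conclusion of
  Prop. 4.12 after the printed base change, l.3385–3386).
* `mkQ_ne_smul_add_of_pow_smul_eq_zero` — the same on the quotient `B = H ⧸ 𝔞 • ⊤`: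
  `ē ≠ X • y + τ` for every `y` and every `X`-power-torsion `τ`.

Proof of Lemma C (ten lines, as in the addendum): from `e = Xh + t` and `ρ𝔞 = 0` get `ρt = 0`, so `ρe = X(ρh)`;
saturation of `R∙e` gives `ρh = s e`, hence `ρ = Xs`; then `X(s − 1) = ρ − X ∈ 𝔞`; if `s` is a unit, `ρ a = 0`
for `a ∈ 𝔞` forces `a = 0`, contradicting `𝔞 ≠ 0`; if `1 − s` is a unit, `X ∈ 𝔞`, contradiction.
What is NOT here: Hida families, Ohta's modules, the identification `C⁰_ψ = (X)` (Betina–Dimitrov), Lemma S/T, or any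
`p`-adic `L`-function. References: BSTW arXiv:2409.01350v2 Part I §4.2, Props. 4.10–4.12 (PREPRINT);
Betina–Dimitrov 2021, Thm. 4.8 and Prop. 1.11 (arXiv:1907.09422 numbering).
-/

namespace Literature.NumberTheory.EllipticCurves.IwasawaTransfer

open Submodule Pointwise

section CongruenceCriterion

variable {R : Type*} [CommRing R] [IsLocalRing R]
variable {H : Type*} [AddCommGroup H] [Module R H]

omit [IsLocalRing R] in
/-- If `X` is a non-zero-divisor on the `R`-module `H`, so is every power `X ^ n`. Private auxiliary.
[folklore] -/
private theorem eq_zero_of_pow_smul_eq_zero {X : R} (hXH : ∀ h : H, X • h = 0 → h = 0) (n : ℕ) (x : H)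
    (hx : X ^ n • x = 0) : x = 0 := by
  induction n generalizing x with
  | zero => simpa using hx
  | succ n ih =>
    rw [pow_succ, mul_smul] at hx
    exact hXH _ (ih _ hx)

/-- **Lemma C (reader 2, D-AUDIT-cgs25-r2-ADDENDUM-3 §2), kernel form — saturation from the congruence ideal.**
`R` a local commutative ring, `H` an `R`-module, `e ∈ H` with trivial annihilator (the line `H⁺ = R ∙ e ≅ R`),
`R ∙ e` saturated in `H` with respect to `X` (`X • h ∈ R ∙ e ⇒ h ∈ R ∙ e`, i.e. `H/H⁺` has no `X`-torsion),
`X` a non-zero-divisor on `H`; `𝔞` an ideal with `𝔞 ≠ 0` and `X ∉ 𝔞`; and `ρ ∈ R` with `ρ 𝔞 = 0` and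
`ρ − X ∈ 𝔞` (i.e. `X` lies in the congruence ideal `π(Ann_R 𝔞)` of `π : R ↠ R/𝔞`). Then for all `h, t ∈ H`
and `N` with `X ^ N • t ∈ 𝔞 • H`: `e ≠ X • h + t`. Equivalently: the image of `e` in `B = H/𝔞H` is not in
`X • B + B[X^∞]`, i.e. the line it spans in `B/B_{X-tors}` is saturated — the conclusion of BSTW Prop. 4.12 after
the printed base change to `Q̄_p⟦X⟧`, obtained WITHOUT the generator count of the printed proof. In the
application the element `ρ` is supplied by Betina–Dimitrov 2021 Thm. 4.8 + Prop. 1.11 (`C⁰_ψ = (X)` on the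
transversal CM branch).
[cite: BurungaleSkinnerTianWan2024, Part I Prop. 4.12 (proof, TeX l.3385–3388: the «it suffices» step `Sat-prop2`; ring-theoretic repair step only = reader 2's Lemma C, D-AUDIT-cgs25-r2-ADDENDUM-3 §2, with the input C⁰_ψ = (X) from BetinaDimitrov2021 Thm. 4.8 + Prop. 1.11; PREPRINT)] -/
theorem ne_smul_add_of_sub_mem_of_mul_eq_zero {X ρ : R} {𝔞 : Ideal R} {e : H}
    (he : ∀ a : R, a • e = 0 → a = 0) (hXH : ∀ h : H, X • h = 0 → h = 0)
    (hsat : ∀ h : H, X • h ∈ R ∙ e → h ∈ R ∙ e)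
    (hρ𝔞 : ∀ a ∈ 𝔞, ρ * a = 0) (hρX : ρ - X ∈ 𝔞) (hX𝔞 : X ∉ 𝔞) (h𝔞 : 𝔞 ≠ ⊥)
    {h t : H} {N : ℕ} (ht : X ^ N • t ∈ 𝔞 • (⊤ : Submodule R H)) :
    e ≠ X • h + t := by
  intro heq
  -- `ρ` kills `𝔞 • H`
  have hρ0 : ∀ x ∈ 𝔞 • (⊤ : Submodule R H), ρ • x = 0 := by
    intro x hx
    refine Submodule.smul_induction_on hx ?_ ?_
    · intro a ha m _
      rw [smul_smul, hρ𝔞 a ha, zero_smul]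
    · intro x y hx hy
      rw [smul_add, hx, hy, add_zero]
  -- hence `ρ • t = 0` (as `X ^ N` is a non-zero-divisor on `H`)
  have hρt : ρ • t = 0 := by
    apply eq_zero_of_pow_smul_eq_zero hXH N
    rw [smul_comm]
    exact hρ0 _ ht
  -- `ρ • e = X • (ρ • h)`
  have hρe : ρ • e = X • (ρ • h) := by
    rw [heq, smul_add, hρt, add_zero]
    exact smul_comm _ _ _
  -- saturation of `R ∙ e`: `ρ • h = s • e`
  have hρh : ρ • h ∈ R ∙ e := hsat _ (by rw [← hρe]; exact smul_mem _ _ (mem_span_singleton_self e))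
  obtain ⟨s, hs⟩ := mem_span_singleton.mp hρh
  -- `ρ = X * s` since `e` has trivial annihilator
  have hρXs : ρ = X * s := by
    have h0 : (ρ - X * s) • e = 0 := by
      rw [sub_smul, mul_smul, hs, ← hρe, sub_self]
    exact sub_eq_zero.mp (he _ h0)
  -- `X * (s - 1) = ρ - X ∈ 𝔞`
  have hXs1 : X * (s - 1) ∈ 𝔞 := by
    have h1 : X * (s - 1) = ρ - X := by rw [hρXs]; ring
    rw [h1]
    exact hρX
  rcases IsLocalRing.isUnit_or_isUnit_one_sub_self s with hsu | h1su
  · -- `s` a unit: then `ρ a = 0` forces `a = 0` for every `a ∈ 𝔞`, so `𝔞 = 0`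
    apply h𝔞
    rw [Submodule.eq_bot_iff]
    intro a ha
    have h1 : (s * a) • e = 0 := by
      apply hXH
      rw [← mul_smul, ← mul_assoc, ← hρXs, hρ𝔞 a ha, zero_smul]
    exact hsu.mul_right_eq_zero.mp (he _ h1)
  · -- `1 - s` a unit: then `X ∈ 𝔞`
    apply hX𝔞
    obtain ⟨u, hu⟩ := h1su
    have key : (1 - s) * ((u⁻¹ : Rˣ) : R) = 1 := by rw [← hu, Units.mul_inv]
    have hX : X = X * (s - 1) * (-((u⁻¹ : Rˣ) : R)) := by
      calc X = X * ((1 - s) * ((u⁻¹ : Rˣ) : R)) := by rw [key, mul_one]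
        _ = X * (s - 1) * (-((u⁻¹ : Rˣ) : R)) := by ring
    rw [hX]
    exact Ideal.mul_mem_right _ _ hXs1

/-- **Lemma C on the quotient `B = H ⧸ 𝔞H`.** Under the hypotheses of
`ne_smul_add_of_sub_mem_of_mul_eq_zero`, the class `ē` of `e` in `B := H ⧸ 𝔞 • ⊤` satisfies
`ē ≠ X • y + τ` for every `y ∈ B` and every `τ ∈ B` killed by a power of `X`: the line `R ∙ ē` meets
`X • B` only modulo no `X`-power torsion, i.e. its image in `B/B[X^∞]` is not divisible by `X` (saturated, when
`R/𝔞` is a discrete valuation ring with uniformiser `X`, as in BSTW Prop. 4.12 where `R/𝔞 = Q̄_p⟦X⟧`).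
[cite: BurungaleSkinnerTianWan2024, Part I Prop. 4.12 (proof, TeX l.3385–3388, `Sat-prop2`; ring-theoretic repair step only = reader 2's Lemma C on the quotient, D-AUDIT-cgs25-r2-ADDENDUM-3 §2; PREPRINT)] -/
theorem mkQ_ne_smul_add_of_pow_smul_eq_zero {X ρ : R} {𝔞 : Ideal R} {e : H}
    (he : ∀ a : R, a • e = 0 → a = 0) (hXH : ∀ h : H, X • h = 0 → h = 0)
    (hsat : ∀ h : H, X • h ∈ R ∙ e → h ∈ R ∙ e)
    (hρ𝔞 : ∀ a ∈ 𝔞, ρ * a = 0) (hρX : ρ - X ∈ 𝔞) (hX𝔞 : X ∉ 𝔞) (h𝔞 : 𝔞 ≠ ⊥)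
    {y τ : H ⧸ (𝔞 • (⊤ : Submodule R H))} {N : ℕ} (hτ : X ^ N • τ = 0) :
    (𝔞 • (⊤ : Submodule R H)).mkQ e ≠ X • y + τ := by
  intro heq
  obtain ⟨h, rfl⟩ := (𝔞 • (⊤ : Submodule R H)).mkQ_surjective y
  obtain ⟨t, rfl⟩ := (𝔞 • (⊤ : Submodule R H)).mkQ_surjective τ
  -- `d := e - (X • h + t) ∈ 𝔞 • H`
  have h1 : (𝔞 • (⊤ : Submodule R H)).mkQ e = (𝔞 • (⊤ : Submodule R H)).mkQ (X • h + t) := by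
    rw [map_add, map_smul]
    exact heq
  have hd : e - (X • h + t) ∈ 𝔞 • (⊤ : Submodule R H) := by
    rw [mkQ_apply, mkQ_apply] at h1
    exact (Submodule.Quotient.eq _).mp h1
  -- `X ^ N • t ∈ 𝔞 • H`
  have ht : X ^ N • t ∈ 𝔞 • (⊤ : Submodule R H) := by
    rw [← map_smul, mkQ_apply, Submodule.Quotient.mk_eq_zero] at hτ
    exact hτ
  -- apply Lemma C with `t' = t + d`
  refine ne_smul_add_of_sub_mem_of_mul_eq_zero he hXH hsat hρ𝔞 hρX hX𝔞 h𝔞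
    (h := h) (t := t + (e - (X • h + t))) (N := N) ?_ ?_
  · rw [smul_add]
    exact add_mem ht (smul_mem _ _ hd)
  · abel

end CongruenceCriterion

end Literature.NumberTheory.EllipticCurves.IwasawaTransfer
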